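import Summits.HubbardSuperconductivity.HubbardSuperconductivity.Theses.KacWindowPenalty
import Summits.HubbardSuperconductivity.HubbardSuperconductivity.Theorems.BalabanIRBirEveryGroundStateSchur

/-!
# Route `KacWindowPenalty` — support item `Sandwich` (stmt-HubbardSuperconductivity-1090)

The Feynman–Hellmann / sandwich variational lemma on a sector: for matrices `H`, `A` on a finite
index type, a subspace `K`, a unit vector `ψ ∈ K` with `H ψ = (minEnergyOn H K) • ψ` and `λ > 0`,
`minEnergyOn (H + λA) K - minEnergyOn H K ≤ λ · re ⟨ψ, A ψ⟩`.
One variational step: `minEnergyOn (H + λA) K ≤ re ⟨ψ, (H + λA) ψ⟩ = minEnergyOn H K + λ re ⟨ψ, A ψ⟩`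
(the Rayleigh set is bounded below on the unit sphere, so Mathlib's real `sInf` is honest). This is
the tree's chord inequality `chord_div_le_re_expect_of_eigen`
(`Theorems/BalabanIRBirEveryGroundStateSchur.lean`) multiplied through by `λ`; no Hermiticity and
no invariance of `K` are needed. Tasaki (2020) §2.1 (variational principle); Wang et al.,
arXiv:2310.05844, §II (certified observables from energy bounds). No new definitions.
-/

-- the mandated namespace `Summit.<Summit>.<Problem>.Theorems` repeats `HubbardSuperconductivity`
-- (single-problem summit, D-0017), which the `dupNamespace` linter flags on every declaration
set_option linter.dupNamespace false

namespace Summit.HubbardSuperconductivity.HubbardSuperconductivity.Theorems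

open Matrix

/-- **Sandwich lemma of route `KacWindowPenalty`** (stmt-HubbardSuperconductivity-1090): for
matrices `H`, `A` on a finite index type `n`, a subspace `K`, a unit vector `ψ ∈ K` with
`H ψ = (minEnergyOn H K) • ψ` and `λ > 0`,
`minEnergyOn (H + λ • A) K - minEnergyOn H K ≤ λ * re ⟨ψ, A ψ⟩`.
Proof: the chord inequality `chord_div_le_re_expect_of_eigen` (variational principle
`minEnergyOn ≤` Rayleigh quotient of `ψ` for `H + λA`, and `re ⟨ψ, H ψ⟩ = minEnergyOn H K` from the
eigen-equation and `‖ψ‖ = 1`), cleared of the division by `λ`.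
Tasaki (2020) §2.1, (2.1.6). [folklore] -/
theorem kacWindowPenalty_sandwich_proof :
    Summit.HubbardSuperconductivity.HubbardSuperconductivity.Theses.KacWindowPenalty.Sandwich := by
  intro n _ _ H A K ψ lam hlam hψK hψ heig
  have h := chord_div_le_re_expect_of_eigen H A K hlam hψK hψ heig
  rw [div_le_iff₀ hlam] at h
  linarith

end Summit.HubbardSuperconductivity.HubbardSuperconductivity.Theorems
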